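import Mathlib
import Summits.ResolutionOfSingularities.ResolutionOfSingularities.Theorems.RadicialJungCleanModelsCleanProp44VeryNearOpens
import Summits.ResolutionOfSingularities.ResolutionOfSingularities.Theorems.RadicialJungCleanModelsCleanChainEscape
import Summits.ResolutionOfSingularities.ResolutionOfSingularities.Theorems.RadicialJungCleanModelsCleanTauTwoSlice
import Summits.ResolutionOfSingularities.ResolutionOfSingularities.Theorems.RadicialJungCleanModelsCleanSeqPatching
import HarnessLib

/-!
# Route `RadicialJung`, crux `CleanModels` (stmt-ResolutionOfSingularities-15917), line `Sketch` rev 35, stub 6 `stub_cleanProp44` (X44c):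
# THE CLEAN POINT STEP WITHOUT LINES — the point part of the `τ = 1` residual only ever stops at a NEAR LINE

Seat decomp-res-hand-2 g16 (structural hand: «reduce to the most general landed lemma in the dossier, then specialise»), continuation of g15's
census ✓ `cleanProp44_of_tauOneResidualVN3 : (R1) → (R2ᵛⁿ′) → (R3ᵛⁿ′) → X44c` and of the tree's non-clean point step
✓ `CP2008Prop44.exists_not_orderReducible_of_point_step` (whose case (P2), the near line, needs the point-step bookkeeping ρ1′ and a CURVE
blowing up — in the clean world a births question, memo 4e §2.4–2.6).  Here, in clean currency and WITHOUT ρ1′: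

* `exists_bad_near_point_of_forall_near_isClosed` — **THE CLEAN POINT STEP WITHOUT LINES** (case (P1) of the point step, clean): `x` a closed
  threefold point of order `m`, isolated in the `m`-stratum of the open `W`, such that NO clean-permissible sequence of `(W, J|_W, m)` for the line
  of `G|_W` brings the order below `m`; `π : X₁ → X` a blowing up at `x` all of whose near points over `x` (order `m`) are CLOSED (no near line).
  Then some near closed threefold point `x'` over `x` has `τ = 1` and a G-ring stalk, is isolated in the `m`-stratum of an open `W' ⊆ π⁻¹W`, and
  `(W', J₁|_{W'}, m)` again admits no such clean sequence (`J₁` the controlled transform, the line that of `π^♯ G`).  Ingredients, all landed: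
  the near locus over `x` is closed (✓ `isClosed_setOf_le_idealOrder_of_isJ2`) and consists of closed points, hence is FINITE (✓ `finite_maxPoints`);
  its points are threefold points (✓ `CP2008Prop44.spanFinrank_eq_three_of_isClosed`) with G-ring stalks (✓ `Scheme.isGRing_stalk_of_isQuasiExcellent`);
  the `τ ≥ 2` ones are settled on an isolating open by the clean slice ✓ `exists_isCleanPermissibleSeq_lt_comap_of_isolated_two_le_tau`; if the
  `τ = 1` ones were settled too, pointwise clean patching ✓ `exists_isCleanPermissibleSeq_lt_of_finite_of_forall_nhds` over `π⁻¹W` (transport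
  along ✓ `exists_isCleanPermissibleSeq_lt_of_isOpenImmersion`) and the point blowing up restricted over `W` (✓ `IsBlowup.restrict`,
  clean-permissible for free ✓ `IsCleanPermissibleSeq.cons_point`, transforms ✓ `comap_controlledTransform_of_flat`, composition
  ✓ `IsCleanPermissibleSeq.comp`) would settle `(W, J|_W, m)`.
* `exists_next_stage_of_nearLine` — **THE STEP OF THE POINTS-ONLY DESCENT under (R2ˡⁱⁿᵉ)**: if the clean `τ = 1` isolated-point slice (R2)
  (`htauOne` of ✓ `cleanProp44_of_tauOneResidual`, binders verbatim) is granted at every point whose blowing up carries a NEAR LINE (a non-closed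
  point `η'` over `x` with `ord_{η'} J₁ = m`), then from every stage `(Y, J, G, W, y)` — standing hypotheses, `y` an isolated `τ = 1` closed
  threefold point of the `m`-stratum of `W` with a G-ring stalk, NO clean sequence on `W` — the blowing up of `y` carries no near line, and the
  point step above produces the NEXT such stage (packaged in an inline `Σ'`-type; no new definition) with its blowing up `π`, `π y' = y` and
  `J' =` the controlled transform.  Iterating it gives an infinite chain of `τ = 1` near closed threefold points under POINT blowing ups, centres
  coincident with `Σ_m` at the chain point for free — the input of ✓ `CP2008Prop44.stub_T1` (iteration: companion file).

Honest framing: OURS; (R2ˡⁱⁿᵉ) is NOT proved here; nothing here proves X44c, any case of `CleanModels`, or resolution of singularities in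
characteristic `p`. [cite: CossartPiltant2008, Prop. 4.2 (b), Lemma 4.3 (1) (3), Prop. 4.4 (proof, pp. 10–11), Lemma 4.5]
[cite: CossartJannsenSaito2020, Thm. 13.7] [cite: Piltant2013, Prop. 5.1 (proof, Step 2)] [cite: GortzWedhorn2020, Prop. 13.91]
-/


noncomputable section

set_option linter.dupNamespace false -- mandated namespace of this single-conjunct summit

open CategoryTheory CategoryTheory.Limits AlgebraicGeometry TopologicalSpace IsLocalRing
open Literature.AlgebraicGeometry.Resolution Literature.AlgebraicGeometry.Motives
open Scheme.IdealSheafData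
open Summit.ResolutionOfSingularities.ResolutionOfSingularities.Theorems.CP2008Prop44

namespace Summit.ResolutionOfSingularities.ResolutionOfSingularities.Theorems.RadicialJung.CleanModels

/-! ## §0 Plumbing -/

/-- A finite set of closed points is closed. [folklore] -/
private theorem isClosed_of_finite_of_forall_isClosed_singleton {α : Type*} [TopologicalSpace α] {S : Set α} (hS : S.Finite)
    (h : ∀ z ∈ S, IsClosed ({z} : Set α)) : IsClosed S := by
  rw [← Set.biUnion_of_singleton S]
  exact hS.isClosed_biUnion fun z hz => h z hz
/-- The stalk ideals of the zero ideal sheaf vanish. [folklore] -/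
private theorem stalkIdeal_bot_pd {X : Scheme.{0}} (x : X) : stalkIdeal (⊥ : X.IdealSheafData) x = ⊥ := by
  obtain ⟨U, hU, hxU, -⟩ := exists_isAffineOpen_mem_and_subset (X := X) (x := x) (U := ⊤) (Opens.mem_top _)
  rw [stalkIdeal_eq_map_germ ⊥ ⟨U, hU⟩ hxU, Scheme.IdealSheafData.ideal_bot, Pi.bot_apply, Ideal.map_bot]
/-- `ord_x(0) = ∞`. [folklore] -/
private theorem idealOrder_bot_eq_top_pd {X : Scheme.{0}} (x : X) : idealOrder (⊥ : X.IdealSheafData) x = ⊤ := by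
  refine eq_top_iff.mpr (ENat.forall_natCast_le_iff_le.mp fun c _ => ?_)
  rw [le_idealOrder_iff, stalkIdeal_bot_pd]
  exact bot_le

/-! ## §1 The clean point step without lines -/

set_option maxHeartbeats 1600000 in
-- long: the near-locus bookkeeping of the point step, the patching over `π⁻¹W` and the composition with the restricted blowing up
/-- **THE CLEAN POINT STEP WITHOUT LINES** (clean twin of ✓ `CP2008Prop44.exists_not_orderReducible_of_point_step`, case (P1)).  `X` integral
Noetherian regular quasi-excellent of dimension `≤ 3`, `char K(X) = p`, the line of `G` clean-regular at every point; `(J, m)` with `m ≥ 1`,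
`ord ≤ m`, `V(J)` of codimension `≥ 2`; `W ∋ x` open, `x` a closed threefold point of order `m`, isolated among the points of order `≥ m` of `W`;
`π : X₁ → X` a blowing up of `x` all of whose near points over `x` are CLOSED; and NO clean-permissible sequence for `(J|_W, m)` and the line of
`G|_W` brings the order below `m`.  THEN some near closed threefold point `x'` over `x` with `τ_{x'} = 1` (a G-ring stalk), isolated among the
points of order `≥ m` of an open `W' ⊆ π⁻¹W`, is such that no clean-permissible sequence for `(J₁|_{W'}, m)` and the line of `(π^♯G)|_{W'}` brings
the order below `m` (`J₁` the controlled transform). [cite: CossartPiltant2008, Prop. 4.4 (proof, pp. 10–11), Lemma 4.3 (1) (3)]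
[cite: Piltant2013, Prop. 5.1 (proof, Step 2)] -/
theorem exists_bad_near_point_of_forall_near_isClosed {p : ℕ} (hp : p.Prime) {X : Scheme.{0}} [IsIntegral X] [IsNoetherian X]
    [hcharX : CharP X.functionField p] (hX : Scheme.IsRegular X) (hqe : Scheme.IsQuasiExcellent X)
    (hX3 : topologicalKrullDim X ≤ 3) (G : X.functionField)
    (hG : ∀ x : X, CleanRegAt p (algebraMap (X.presheaf.stalk x) X.functionField) G)
    (J : X.IdealSheafData) {m : ℕ} (hm : 1 ≤ m) (hle : ∀ z, idealOrder J z ≤ m) (hcodim : ∀ z ∈ J.support, 1 < Order.coheight z)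
    (W : X.Opens) (x : X) (hxW : x ∈ W) (hcl : IsClosed ({x} : Set X))
    (hbad : ∀ z : X, (m : ℕ∞) ≤ idealOrder J z → z = x ∨ z ∉ (W : Set X)) (hord : idealOrder J x = m)
    (hdim : (maximalIdeal (X.presheaf.stalk x)).spanFinrank = 3)
    {X₁ : Scheme.{0}} (π : X₁ ⟶ X) (hπ : IsBlowup π (vanishingIdeal ⟨{x}, hcl⟩))
    (hnl : ∀ η : X₁, π η = x → idealOrder (controlledTransform π (vanishingIdeal ⟨{x}, hcl⟩) J m) η = m → IsClosed ({η} : Set X₁))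
    (hnot : ¬ ∀ [IsIntegral ((W : X.Opens) : Scheme.{0})] [IsDominant W.ι],
      ∃ (V' : Scheme.{0}) (ϖ : V' ⟶ W) (_ : IsIntegral V') (_ : IsDominant ϖ) (K' : V'.IdealSheafData),
        IsCleanPermissibleSeq p ϖ (J.comap W.ι) m K' (RatFn.functionFieldMap W.ι G) ∧ ∀ y, idealOrder K' y < m) :
    ∃ (_ : IsIntegral X₁) (_ : IsNoetherian X₁) (hX₁ : Scheme.IsRegular X₁) (_ : Scheme.IsQuasiExcellent X₁)
      (_ : topologicalKrullDim X₁ ≤ 3) (_ : IsDominant π) (_ : CharP X₁.functionField p)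
      (_ : ∀ x' : X₁, CleanRegAt p (algebraMap (X₁.presheaf.stalk x') X₁.functionField) (RatFn.functionFieldMap π G))
      (_ : ∀ z, idealOrder (controlledTransform π (vanishingIdeal ⟨{x}, hcl⟩) J m) z ≤ m)
      (_ : ∀ z ∈ (controlledTransform π (vanishingIdeal ⟨{x}, hcl⟩) J m).support, 1 < Order.coheight z)
      (x' : X₁) (_ : π x' = x) (_ : IsNear π (vanishingIdeal ⟨{x}, hcl⟩) J m x') (W' : X₁.Opens) (_ : x' ∈ W')
      (_ : W' ≤ π ⁻¹ᵁ W) (_ : IsClosed ({x'} : Set X₁))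
      (_ : ∀ z : X₁, (m : ℕ∞) ≤ idealOrder (controlledTransform π (vanishingIdeal ⟨{x}, hcl⟩) J m) z → z = x' ∨ z ∉ (W' : Set X₁))
      (_ : idealOrder (controlledTransform π (vanishingIdeal ⟨{x}, hcl⟩) J m) x' = m)
      (_ : (maximalIdeal (X₁.presheaf.stalk x')).spanFinrank = 3)
      (_ : haveI := hX₁ x'; stalkTau (controlledTransform π (vanishingIdeal ⟨{x}, hcl⟩) J m) x' m = 1)
      (_ : IsGRing (X₁.presheaf.stalk x')),
      ¬ ∀ [IsIntegral ((W' : X₁.Opens) : Scheme.{0})] [IsDominant W'.ι],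
        ∃ (V' : Scheme.{0}) (ϖ : V' ⟶ W') (_ : IsIntegral V') (_ : IsDominant ϖ) (K' : V'.IdealSheafData),
          IsCleanPermissibleSeq p ϖ ((controlledTransform π (vanishingIdeal ⟨{x}, hcl⟩) J m).comap W'.ι) m K'
            (RatFn.functionFieldMap W'.ι (RatFn.functionFieldMap π G)) ∧ ∀ y, idealOrder K' y < m := by
  classical
  -- §a the blowing up and the invariants of `X₁`
  set D : Closeds X := ⟨{x}, hcl⟩ with hDdef
  have hDreg : Scheme.IsRegular (vanishingIdeal D).subscheme := CampaignW46.isRegular_subscheme_vanishingIdeal_singleton hcl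
  have hDint : IsIntegral (vanishingIdeal D).subscheme := isIntegral_subscheme_vanishingIdeal_singleton hcl
  have hY : ∀ y ∈ (D : Set X), idealOrder J y = m := fun y hy => by
    rw [show y = x from hy]; exact hord
  have hDm : ∀ y ∈ (D : Set X), (m : ℕ∞) ≤ idealOrder J y := fun y hy => (hY y hy).ge
  have hJne : J ≠ ⊥ := ne_bot_of_forall_one_lt_coheight hcodim
  have hDne : vanishingIdeal D ≠ ⊥ := vanishingIdeal_ne_bot_of_forall_idealOrder_eq hJne hm hY
  haveI hint₁ : IsIntegral X₁ := hπ.isIntegral hDne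
  haveI hdomπ : IsDominant π := isDominant_of_isBlowup_of_ne_bot hπ hDne
  have hseq1 : CampaignW46.IsPermissibleBlowupSeq J m π (controlledTransform π (vanishingIdeal D) J m) :=
    CampaignW46.IsPermissibleBlowupSeq.single D π hDreg hDm hπ
  obtain ⟨-, hnoeth', hX', hqe', hle', hcodim'⟩ := IsPermissibleBlowupSeq.prop44Invariants hX hqe hm hle hcodim hseq1
  haveI := hnoeth'
  have hX3' : topologicalKrullDim X₁ ≤ 3 := hπ.topologicalKrullDim_le hX3
  have hcoh3' : ∀ z : X₁, Order.coheight z ≤ 3 := (topologicalKrullDim_le_iff_forall_coheight_le X₁ 3).mp hX3'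
  haveI : IsRegularLocalRing (X.presheaf.stalk x) := hX x
  haveI hcharX₁ : CharP X₁.functionField p := charP_of_injective_ringHom (RatFn.functionFieldMap π).injective p
  set J' := controlledTransform π (vanishingIdeal D) J m with hJ'def
  -- the one-step clean-permissible sequence on `X` and the clean data upstairs
  have hseqX : IsCleanPermissibleSeq p (π ≫ 𝟙 X) J m J' G :=
    IsCleanPermissibleSeq.cons_point hp π (𝟙 X) J m J G (IsCleanPermissibleSeq.nil J m G) x hcl hDint hDreg hord hπ
      (by rw [RatFn.functionFieldMap_id]; exact hG x)
  have hseqX' : IsCleanPermissibleSeq p π J m J' G := by simpa only [Category.comp_id] using hseqX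
  have hG₁ : ∀ z : X₁, CleanRegAt p (algebraMap (X₁.presheaf.stalk z) X₁.functionField) (RatFn.functionFieldMap π G) :=
    hseqX'.cleanRegAt hp hcharX hG
  -- §b the points of order `≥ m`: near points over `x`, or over the complement of `W`
  have hoff : ∀ z : X₁, π z ≠ x → (m : ℕ∞) ≤ idealOrder J' z → π z ∉ (W : Set X) := by
    intro z hπz hz
    have hz' : π z ∉ ((vanishingIdeal D).support : Set X) := by
      rw [Scheme.IdealSheafData.coe_support_vanishingIdeal]; exact hπz
    rw [hJ'def, hπ.idealOrder_controlledTransform_of_not_mem J m hz'] at hz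
    exact (hbad (π z) hz).elim (fun h => absurd h hπz) id
  have hnear_of : ∀ z : X₁, π z = x → (m : ℕ∞) ≤ idealOrder J' z → IsNear π (vanishingIdeal D) J m z := by
    intro z hπz hz
    have hle := hπ.idealOrder_controlledTransform_le_of_mem hX hDreg hY (x' := z) (by rw [hπz]; rfl)
    exact isNear_iff.mpr (le_antisymm hle hz)
  -- §c the near locus over `x`: closed, all of its points closed, hence FINITE
  set T₀ : Set X₁ := {z : X₁ | (m : ℕ∞) ≤ idealOrder J' z ∧ π z = x} with hT₀def
  have hJ'ne : J' ≠ ⊥ := ne_bot_of_forall_one_lt_coheight hcodim'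
  have hOrdCl : IsClosed {z : X₁ | (m : ℕ∞) ≤ idealOrder J' z} :=
    isClosed_setOf_le_idealOrder_of_isJ2 hX' (fun U => (hqe' U).isJ2Ring) hJ'ne m
  have hT₀cl : IsClosed T₀ := by
    have h2 : IsClosed {z : X₁ | π z = x} := hcl.preimage π.continuous
    exact hOrdCl.inter h2
  have hT₀W : T₀ ⊆ ((π ⁻¹ᵁ W : X₁.Opens) : Set X₁) := fun z hz => by
    show π z ∈ (W : Set X); rw [hz.2]; exact hxW
  have hT₀pt : ∀ z ∈ T₀, IsClosed ({z} : Set X₁) := fun z hz =>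
    hnl z hz.2 (le_antisymm (hle' z) hz.1)
  have hT₀max : T₀ ⊆ maxPoints T₀ := by
    intro z hz
    refine ⟨hz, fun ζ hζ hζz => ?_⟩
    have hmem : z ∈ closure ({ζ} : Set X₁) := specializes_iff_mem_closure.mp hζz
    rw [(hT₀pt ζ hζ).closure_eq] at hmem; exact (Set.mem_singleton_iff.mp hmem).symm
  have hT₀fin : T₀.Finite := (finite_maxPoints hT₀cl).subset hT₀max
  -- every point of order `≥ m` over `W` lies in `T₀`
  have hcov : ∀ z : X₁, z ∈ ((π ⁻¹ᵁ W : X₁.Opens) : Set X₁) → (m : ℕ∞) ≤ idealOrder J' z → z ∈ T₀ := by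
    intro z hzW hz
    refine ⟨hz, ?_⟩
    by_contra hne
    exact hoff z hne hz hzW
  -- data at the points of `T₀`
  have hT₀near : ∀ z ∈ T₀, IsNear π (vanishingIdeal D) J m z := fun z hz => hnear_of z hz.2 hz.1
  have hT₀ord : ∀ z ∈ T₀, idealOrder J' z = m := fun z hz => isNear_iff.mp (hT₀near z hz)
  have hT₀dim : ∀ z ∈ T₀, (maximalIdeal (X₁.presheaf.stalk z)).spanFinrank = 3 := by
    intro z hz
    haveI : IsRegularLocalRing (X₁.presheaf.stalk z) := hX' _
    haveI : IsRegularLocalRing (X.presheaf.stalk (π z)) := hX _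
    exact spanFinrank_eq_three_of_isClosed hπ (hT₀pt z hz) (by rw [CampaignW46.spanFinrank_maximalIdeal_congr hz.2]; exact hdim)
  have hT₀G : ∀ z ∈ T₀, IsGRing (X₁.presheaf.stalk z) := fun z _ => Scheme.isGRing_stalk_of_isQuasiExcellent hqe' _
  -- the isolating opens `W'_z = π⁻¹W ∖ (T₀ ∖ {z})`
  have hrestcl : ∀ z : X₁, IsClosed (T₀ \ {z}) := fun z =>
    isClosed_of_finite_of_forall_isClosed_singleton (hT₀fin.subset fun w hw => hw.1) fun w hw => hT₀pt w hw.1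
  let W₁ : X₁ → X₁.Opens := fun z => ⟨((π ⁻¹ᵁ W : X₁.Opens) : Set X₁) \ (T₀ \ {z}), (π ⁻¹ᵁ W).2.sdiff (hrestcl z)⟩
  have hW₁le : ∀ z, W₁ z ≤ π ⁻¹ᵁ W := fun z w hw => hw.1
  have hzW₁ : ∀ z ∈ T₀, z ∈ W₁ z := fun z hz => ⟨hT₀W hz, fun h => h.2 rfl⟩
  have hW₁bad : ∀ z ∈ T₀, ∀ w : X₁, (m : ℕ∞) ≤ idealOrder J' w → w = z ∨ w ∉ (W₁ z : Set X₁) := by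
    intro z _ w hw
    by_cases hwz : w = z
    · exact Or.inl hwz
    · exact Or.inr fun hwW => hwW.2 ⟨hcov w hwW.1 hw, hwz⟩
  -- §d if every `τ = 1` point of `T₀` were settled on every isolating open, `(W, J|_W, m)` would be settled
  by_contra hnone
  push Not at hnone
  apply hnot
  intro hWint hWdom
  -- every point of `T₀` is settled on `W'_z`
  have hsettled : ∀ z ∈ T₀, ∀ [IsIntegral ((W₁ z : X₁.Opens) : Scheme.{0})] [IsDominant (W₁ z).ι],
      ∃ (V' : Scheme.{0}) (ϖ : V' ⟶ W₁ z) (_ : IsIntegral V') (_ : IsDominant ϖ) (K' : V'.IdealSheafData),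
        IsCleanPermissibleSeq p ϖ (J'.comap (W₁ z).ι) m K' (RatFn.functionFieldMap (W₁ z).ι (RatFn.functionFieldMap π G)) ∧
          ∀ y, idealOrder K' y < m := by
    intro z hz _ _
    haveI : IsRegularLocalRing (X₁.presheaf.stalk z) := hX' z
    by_cases hτ : stalkTau J' z m = 1
    · exact hnone hint₁ hnoeth' hX' hqe' hX3' hdomπ hcharX₁ hG₁ hle' hcodim' z hz.2 (hT₀near z hz) (W₁ z) (hzW₁ z hz) (hW₁le z)
        (hT₀pt z hz) (hW₁bad z hz) (hT₀ord z hz) (hT₀dim z hz) hτ (hT₀G z hz)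
    · have hτ2 : 2 ≤ stalkTau J' z m := by
        have h : 1 ≤ stalkTau J' z m := (hT₀near z hz).one_le_stalkTau hm
        omega
      exact exists_isCleanPermissibleSeq_lt_comap_of_isolated_two_le_tau hp hX' J' hm (RatFn.functionFieldMap π G) hG₁ (W₁ z) z
        (hzW₁ z hz) (hT₀pt z hz) (hW₁bad z hz) (hT₀ord z hz) (hT₀dim z hz) hτ2 (hT₀G z hz)
  -- §e patching over `U = π⁻¹W`
  set U : X₁.Opens := π ⁻¹ᵁ W with hUdef
  -- the restricted blowing up `π|_W : U → W` is the blowing up of `W` at `x`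
  set x₀ : (W : Scheme.{0}) := ⟨x, hxW⟩ with hx₀def
  have hιx₀ : W.ι x₀ = x := by simp [hx₀def, Scheme.Opens.ι_apply]
  have hclW : IsClosed ({x₀} : Set (W : Scheme.{0})) := by
    have : ({x₀} : Set (W : Scheme.{0})) = W.ι ⁻¹' {x} := by
      ext w
      simp only [Set.mem_singleton_iff, Set.mem_preimage]
      constructor
      · rintro rfl; exact hιx₀
      · intro h; exact W.ι.isOpenEmbedding.injective (h.trans hιx₀.symm)
    rw [this]
    exact hcl.preimage W.ι.continuous
  have hpre : D.preimage W.ι.continuous = (⟨{x₀}, hclW⟩ : Closeds (W : Scheme.{0})) := by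
    apply Closeds.ext
    ext w
    simp only [Closeds.coe_preimage, Set.mem_preimage, hDdef, Closeds.coe_mk, Set.mem_singleton_iff]
    constructor
    · intro h; exact W.ι.isOpenEmbedding.injective (h.trans hιx₀.symm)
    · rintro rfl; exact hιx₀
  have hCW : (vanishingIdeal D).comap W.ι = vanishingIdeal ⟨{x₀}, hclW⟩ := by
    rw [comap_vanishingIdeal_of_isOpenImmersion W.ι D, hpre]
  have hπW : IsBlowup (π ∣_ W) (vanishingIdeal ⟨{x₀}, hclW⟩) := by
    rw [← hCW]; exact hπ.restrict W
  -- `W` inherits the standing hypotheses needed by `cons_point`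
  haveI : IsLocallyNoetherian ((W : X.Opens) : Scheme.{0}) := LocallyOfFiniteType.isLocallyNoetherian W.ι
  haveI hcharW : CharP (W : Scheme.{0}).functionField p := charP_of_injective_ringHom (RatFn.functionFieldMap W.ι).injective p
  have hordx₀ : idealOrder (J.comap W.ι) x₀ = m := by rw [idealOrder_comap_of_isOpenImmersion W.ι J x₀, hιx₀, hord]
  have hJWne : J.comap W.ι ≠ ⊥ := by
    intro h
    have h1 := hordx₀
    rw [h, idealOrder_bot_eq_top_pd] at h1
    exact ENat.top_ne_coe m h1
  have hx₀Y : ∀ y ∈ ((⟨{x₀}, hclW⟩ : Closeds (W : Scheme.{0})) : Set (W : Scheme.{0})), idealOrder (J.comap W.ι) y = m :=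
    forall_mem_closeds_singleton_idealOrder_eq hclW hordx₀
  have hx₀ne : vanishingIdeal (⟨{x₀}, hclW⟩ : Closeds (W : Scheme.{0})) ≠ ⊥ :=
    vanishingIdeal_ne_bot_of_forall_idealOrder_eq hJWne hm hx₀Y
  haveI hUint : IsIntegral ((U : X₁.Opens) : Scheme.{0}) := hπW.isIntegral hx₀ne
  haveI hπWdom : IsDominant (π ∣_ W) := isDominant_of_isBlowup_of_ne_bot hπW hx₀ne
  haveI : IsDominant U.ι := isDominant_of_isOpenImmersion _
  haveI : IsLocallyNoetherian ((U : X₁.Opens) : Scheme.{0}) := LocallyOfFiniteType.isLocallyNoetherian U.ι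
  have hseqW : IsCleanPermissibleSeq p ((π ∣_ W) ≫ 𝟙 (W : Scheme.{0})) (J.comap W.ι) m
      (controlledTransform (π ∣_ W) (vanishingIdeal ⟨{x₀}, hclW⟩) (J.comap W.ι) m) (RatFn.functionFieldMap W.ι G) :=
    IsCleanPermissibleSeq.cons_point hp (π ∣_ W) (𝟙 _) (J.comap W.ι) m (J.comap W.ι) (RatFn.functionFieldMap W.ι G)
      (IsCleanPermissibleSeq.nil _ m _) x₀ hclW (isIntegral_subscheme_vanishingIdeal_singleton hclW)
      (CampaignW46.isRegular_subscheme_vanishingIdeal_singleton hclW) hordx₀ hπW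
      (by rw [RatFn.functionFieldMap_id]; exact CleanRegAt.functionFieldMap_of_isIso_stalkMap W.ι x₀ (hιx₀ ▸ hG x))
  have hsq : U.ι ≫ π = (π ∣_ W) ≫ W.ι := (morphismRestrict_ι π W).symm
  have hCT : J'.comap U.ι = controlledTransform (π ∣_ W) (vanishingIdeal ⟨{x₀}, hclW⟩) (J.comap W.ι) m := by
    rw [← hCW, hJ'def]
    exact comap_controlledTransform_of_flat W.ι hsq (vanishingIdeal D) J m
  have hseqW' : IsCleanPermissibleSeq p (π ∣_ W) (J.comap W.ι) m (J'.comap U.ι) (RatFn.functionFieldMap W.ι G) := by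
    rw [hCT]
    simpa only [Category.comp_id] using hseqW
  have hGU : RatFn.functionFieldMap U.ι (RatFn.functionFieldMap π G) = RatFn.functionFieldMap (π ∣_ W) (RatFn.functionFieldMap W.ι G) := by
    rw [← RingHom.comp_apply, ← RatFn.functionFieldMap_comp, RatFn.functionFieldMap_congr hsq, RatFn.functionFieldMap_comp,
      RingHom.comp_apply]
  -- the conclusion on `U`, by pointwise-local clean patching over the finite set `T₀`
  have hU : ∃ (U' : Scheme.{0}) (ϖ : U' ⟶ U) (_ : IsIntegral U') (_ : IsDominant ϖ) (K' : U'.IdealSheafData),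
      IsCleanPermissibleSeq p ϖ (J'.comap U.ι) m K' (RatFn.functionFieldMap U.ι (RatFn.functionFieldMap π G)) ∧
        ∀ y, idealOrder K' y < m := by
    refine exists_isCleanPermissibleSeq_lt_of_finite_of_forall_nhds (J'.comap U.ι) (RatFn.functionFieldMap U.ι (RatFn.functionFieldMap π G))
      (U.ι ⁻¹' T₀) (hT₀fin.preimage U.ι.isOpenEmbedding.injective.injOn) (fun u hu => ?_) (fun u hu => ?_) (fun u hu => ?_)
    · -- closed points
      have : ({u} : Set (U : Scheme.{0})) = U.ι ⁻¹' {U.ι u} := by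
        ext w
        simp only [Set.mem_singleton_iff, Set.mem_preimage]
        constructor
        · rintro rfl; rfl
        · intro h; exact U.ι.isOpenEmbedding.injective h
      rw [this]
      exact (hT₀pt _ hu).preimage U.ι.continuous
    · -- the `m`-stratum of `U` lies over `T₀`
      rw [idealOrder_comap_of_isOpenImmersion U.ι J' u] at hu
      have hmem : U.ι u ∈ ((U : X₁.Opens) : Set X₁) := by rw [← Scheme.Opens.range_ι U]; exact ⟨u, rfl⟩
      exact hcov _ hmem hu
    · -- the local conclusion around `u`, transported from `W'_{U.ι u}` along the open immersion `U.ι⁻¹ W'_z → W'_z`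
      set z : X₁ := U.ι u with hzdef
      have hz : z ∈ T₀ := hu
      refine ⟨U.ι ⁻¹ᵁ (W₁ z), hzW₁ z hz, ?_⟩
      intro _ _
      haveI : Nonempty ((W₁ z : X₁.Opens) : Scheme.{0}) := ⟨⟨z, hzW₁ z hz⟩⟩
      haveI : IsIntegral ((W₁ z : X₁.Opens) : Scheme.{0}) := isIntegral_of_isOpenImmersion (W₁ z).ι
      haveI : IsDominant (W₁ z).ι := isDominant_of_isOpenImmersion _
      haveI : IsLocallyNoetherian ((W₁ z : X₁.Opens) : Scheme.{0}) := LocallyOfFiniteType.isLocallyNoetherian (W₁ z).ι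
      -- the comparison open immersion
      have hrange : Set.range ((U.ι ⁻¹ᵁ (W₁ z)).ι ≫ U.ι).base ⊆ Set.range (W₁ z).ι.base := by
        rintro _ ⟨w, rfl⟩
        rw [Scheme.Opens.range_ι]
        exact w.2
      set e : ((U.ι ⁻¹ᵁ (W₁ z) : U.toScheme.Opens) : Scheme.{0}) ⟶ (W₁ z : Scheme.{0}) :=
        IsOpenImmersion.lift (W₁ z).ι ((U.ι ⁻¹ᵁ (W₁ z)).ι ≫ U.ι) hrange with hedef
      have he : e ≫ (W₁ z).ι = (U.ι ⁻¹ᵁ (W₁ z)).ι ≫ U.ι := IsOpenImmersion.lift_fac _ _ _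
      haveI : IsOpenImmersion (e ≫ (W₁ z).ι) := by rw [he]; infer_instance
      haveI : IsOpenImmersion e := IsOpenImmersion.of_comp e (W₁ z).ι
      haveI : IsDominant e := isDominant_of_isOpenImmersion _
      obtain ⟨V', ϖ, hV', hϖ, K', hseq, hlt⟩ := exists_isCleanPermissibleSeq_lt_of_isOpenImmersion e (hsettled z hz)
      refine ⟨V', ϖ, hV', hϖ, K', ?_, hlt⟩
      have hJ'' : (J'.comap (W₁ z).ι).comap e = (J'.comap U.ι).comap (U.ι ⁻¹ᵁ (W₁ z)).ι := by
        rw [← Scheme.IdealSheafData.comap_comp, ← Scheme.IdealSheafData.comap_comp, he]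
      have hG'' : RatFn.functionFieldMap e (RatFn.functionFieldMap (W₁ z).ι (RatFn.functionFieldMap π G)) =
          RatFn.functionFieldMap (U.ι ⁻¹ᵁ (W₁ z)).ι (RatFn.functionFieldMap U.ι (RatFn.functionFieldMap π G)) := by
        rw [← RingHom.comp_apply, ← RatFn.functionFieldMap_comp, RatFn.functionFieldMap_congr he, RatFn.functionFieldMap_comp,
          RingHom.comp_apply]
      rw [hJ'', hG''] at hseq
      exact hseq
  -- compose with the restricted blowing up
  obtain ⟨U', ϖ, hU', hϖ, K', hseqU, hlt⟩ := hU
  haveI := hU'; haveI := hϖ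
  exact ⟨U', ϖ ≫ (π ∣_ W), inferInstance, inferInstance, K', hseqW'.comp hseqU hGU, hlt⟩

/-! ## §2a The step of the descent (bundled output) -/

set_option maxHeartbeats 1600000 in
-- the next stage is packaged in an inline `Σ'`-type (no new definition)
/-- **The step of the points-only descent** (technical form of `exists_bad_near_point_of_forall_near_isClosed` under the hypothesis (R2ˡⁱⁿᵉ)
`hline`): from a stage `(Y, J, G, W, y)` of the descent — standing hypotheses, `y` an isolated `τ = 1` closed threefold point of the `m`-stratum of
the open `W` with a G-ring stalk, and NO clean sequence on `W` — the blowing up of `y` carries no near line (by `hline`), so the clean point step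
without lines yields the NEXT stage, packaged as a dependent tuple, together with the blowing up `π`, `π y' = y`, and `J' = ` the controlled
transform. [cite: CossartPiltant2008, Prop. 4.4 (proof, p. 11)] -/
theorem exists_next_stage_of_nearLine {p : ℕ} (hp : p.Prime) {m : ℕ} (hm : 1 ≤ m)
    (hline : ∀ {X : Scheme.{0}} [IsIntegral X] [IsNoetherian X], CharP X.functionField p →
      ∀ (hX : Scheme.IsRegular X), Scheme.IsQuasiExcellent X → topologicalKrullDim X ≤ 3 →
      ∀ (G : X.functionField), (∀ x : X, CleanRegAt p (algebraMap (X.presheaf.stalk x) X.functionField) G) →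
      ∀ (J : X.IdealSheafData), (∀ z, idealOrder J z ≤ m) → (∀ z ∈ J.support, 1 < Order.coheight z) →
      ∀ (V : X.Opens) (x : X), x ∈ V → ∀ (hcl : IsClosed ({x} : Set X)),
      (∀ z : X, (m : ℕ∞) ≤ idealOrder J z → z = x ∨ z ∉ (V : Set X)) → idealOrder J x = m →
      (maximalIdeal (X.presheaf.stalk x)).spanFinrank = 3 → (haveI := hX x; stalkTau J x m = 1) → IsGRing (X.presheaf.stalk x) →
      -- (LINE) some blowing up of `X` at `x` carries a near line over `x`
      (∃ (X₁ : Scheme.{0}) (π : X₁ ⟶ X), IsBlowup π (vanishingIdeal ⟨{x}, hcl⟩) ∧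
        ∃ η : X₁, π η = x ∧ idealOrder (controlledTransform π (vanishingIdeal ⟨{x}, hcl⟩) J m) η = m ∧ ¬ IsClosed ({η} : Set X₁)) →
      ∀ [IsIntegral ((V : X.Opens) : Scheme.{0})] [IsDominant V.ι],
      ∃ (V' : Scheme.{0}) (π : V' ⟶ V) (_ : IsIntegral V') (_ : IsDominant π) (K' : V'.IdealSheafData),
        IsCleanPermissibleSeq p π (J.comap V.ι) m K' (RatFn.functionFieldMap V.ι G) ∧ ∀ y, idealOrder K' y < m)
    (Y : Scheme.{0}) (hYi : IsIntegral Y) (hYn : IsNoetherian Y) (JY : Y.IdealSheafData) (GY : Y.functionField)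
      (W : Y.Opens) (y : Y) :
      (CharP Y.functionField p ∧ Scheme.IsRegular Y ∧ Scheme.IsQuasiExcellent Y ∧ topologicalKrullDim Y ≤ 3 ∧
      (∀ z : Y, CleanRegAt p (algebraMap (Y.presheaf.stalk z) Y.functionField) GY) ∧
      (∀ z, idealOrder JY z ≤ m) ∧ (∀ z ∈ JY.support, 1 < Order.coheight z) ∧ y ∈ W ∧ IsClosed ({y} : Set Y) ∧
      (∀ z : Y, (m : ℕ∞) ≤ idealOrder JY z → z = y ∨ z ∉ (W : Set Y)) ∧ idealOrder JY y = m ∧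
      (maximalIdeal (Y.presheaf.stalk y)).spanFinrank = 3 ∧ (∀ h : IsRegularLocalRing (Y.presheaf.stalk y), @stalkTau Y JY y h m = 1) ∧
      IsGRing (Y.presheaf.stalk y) ∧
      ¬ ∀ [IsIntegral ((W : Y.Opens) : Scheme.{0})] [IsDominant W.ι],
        ∃ (V' : Scheme.{0}) (ϖ : V' ⟶ W) (_ : IsIntegral V') (_ : IsDominant ϖ) (K' : V'.IdealSheafData),
          IsCleanPermissibleSeq p ϖ (JY.comap W.ι) m K' (RatFn.functionFieldMap W.ι GY) ∧ ∀ y, idealOrder K' y < m) →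
      ∃ (s' : Σ' (Y : Scheme.{0}) (_ : IsIntegral Y) (_ : IsNoetherian Y) (JY : Y.IdealSheafData) (GY : Y.functionField)
      (W : Y.Opens) (y : Y),
      CharP Y.functionField p ∧ Scheme.IsRegular Y ∧ Scheme.IsQuasiExcellent Y ∧ topologicalKrullDim Y ≤ 3 ∧
        (∀ z : Y, CleanRegAt p (algebraMap (Y.presheaf.stalk z) Y.functionField) GY) ∧
        (∀ z, idealOrder JY z ≤ m) ∧ (∀ z ∈ JY.support, 1 < Order.coheight z) ∧ y ∈ W ∧ IsClosed ({y} : Set Y) ∧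
        (∀ z : Y, (m : ℕ∞) ≤ idealOrder JY z → z = y ∨ z ∉ (W : Set Y)) ∧ idealOrder JY y = m ∧
        (maximalIdeal (Y.presheaf.stalk y)).spanFinrank = 3 ∧ (∀ h : IsRegularLocalRing (Y.presheaf.stalk y), @stalkTau Y JY y h m = 1) ∧
        IsGRing (Y.presheaf.stalk y) ∧
        ¬ ∀ [IsIntegral ((W : Y.Opens) : Scheme.{0})] [IsDominant W.ι],
          ∃ (V' : Scheme.{0}) (ϖ : V' ⟶ W) (_ : IsIntegral V') (_ : IsDominant ϖ) (K' : V'.IdealSheafData),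
            IsCleanPermissibleSeq p ϖ (JY.comap W.ι) m K' (RatFn.functionFieldMap W.ι GY) ∧ ∀ y, idealOrder K' y < m) (hc : IsClosed ({y} : Set Y)) (π : s'.1 ⟶ Y),
        IsBlowup π (vanishingIdeal ⟨{y}, hc⟩) ∧ π s'.2.2.2.2.2.2.1 = y ∧
          s'.2.2.2.1 = controlledTransform π (vanishingIdeal ⟨{y}, hc⟩) JY m := by
  intro hgood
  obtain ⟨hchar, hYreg, hYqe, hY3, hGY, hleY, hcodimY, hyW, hycl, hbadY, hordY, hdimY, hτY, hGrY, hbadW⟩ := hgood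
  haveI := hchar
  have hb := Literature.AlgebraicGeometry.Resolution.exists_isBlowup Y (vanishingIdeal (⟨{y}, hycl⟩ : Closeds Y))
  rcases hb with ⟨X₁, π, hπ⟩
  -- no near line over `y`: otherwise `hline` settles `(W, J|_W, m)`
  have hnl : ∀ η : X₁, π η = y → idealOrder (controlledTransform π (vanishingIdeal ⟨{y}, hycl⟩) JY m) η = m →
      IsClosed ({η} : Set X₁) := by
    intro η hη hordη
    by_contra hηcl
    apply hbadW
    intro hWi hWd
    exact hline hchar hYreg hYqe hY3 GY hGY JY hleY hcodimY W y hyW hycl hbadY hordY hdimY (hτY (hYreg y)) hGrY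
      ⟨X₁, π, hπ, η, hη, hordη, hηcl⟩
  have hnext := exists_bad_near_point_of_forall_near_isClosed hp hYreg hYqe hY3 GY hGY JY hm hleY hcodimY W y hyW hycl hbadY hordY
    hdimY π hπ hnl hbadW
  rcases hnext with ⟨hint₁, hnoeth₁, hX₁, hqe₁, hX3₁, hdom₁, hchar₁, hG₁, hle₁, hcodim₁, x', hx'y, -, W', hx'W', -, hx'cl, hbad', hord',
    hdim', hτ', hGr', hbadW'⟩
  refine ⟨⟨X₁, hint₁, hnoeth₁, controlledTransform π (vanishingIdeal ⟨{y}, hycl⟩) JY m, RatFn.functionFieldMap π GY, W', x', hchar₁,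
    hX₁, hqe₁, hX3₁, hG₁, hle₁, hcodim₁, hx'W', hx'cl, hbad', hord', hdim', fun h => hτ', hGr', fun h => hbadW' h⟩, hycl, π, ?_, ?_, ?_⟩
  exacts [hπ, hx'y, rfl]

end Summit.ResolutionOfSingularities.ResolutionOfSingularities.Theorems.RadicialJung.CleanModels

end
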